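import Summits.NavierStokesRegularity.NavierStokesRegularity.Theorems.AxisymmetricExtremalityAxisymmetricKatoGlobalStubSeregin2020TypeIILemma22ExcisionSchedule
import HarnessLib

/-!
# L22-B, piece F3c (4/·): the bad set of a cover and the `ε → 0` limit tools

Seregin 2020 Lemma 2.2 ⇐ N–U 2012 Lemma 4.2 for the class `𝒱` (cell ns-inputs, kit A1-L22B-F3, route P).
For a finite cover of `S ∩ K` by centred parabolic cylinders `Q*_{rᵢ}(zᵢ)` the *bad set* is
`Bad = ⋃ᵢ [tᵢ-2rᵢ², tᵢ+2rᵢ²] × B(xᵢ, 4rᵢ)` — the only place where the excision cut-offs differ from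
`1`.  This file proves:
* `eventually_notMem_badSet` — if every cylinder of the `n`-th cover meets the closed set `C`
  and the radii sum to `≤ εₙ → 0`, a point off `C` is outside `Badₙ` for all large `n`
  (`le_dist_of_meeting`);
* `lintegral_le_liminf_lintegral_indicator_compl` — Fatou for the dissipation:
  `∫⁻ f ≤ liminf ∫⁻ 1_{Badₙᶜ} f` when a.e. point is eventually outside `Badₙ`;
* `tendsto_setIntegral_indicator_norm_zero` — dominated convergence for the drift / axis terms:
  `∫ 1_{Badₙ} ‖g‖ → 0` for `g` integrable;
* `abs_integral_weight_sub_le`, `lintegral_indicator_compl_le_weight`, `integral_weight_le` — the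
  per-piece comparisons between `φ²`-weighted and unweighted integrals when `φ = 1` off `Bad`,
  `0 ≤ φ ≤ 1`.
[cite: NazarovUraltseva2012, §3 (3.9), Remark 9]

Nothing here is a Navier–Stokes regularity statement.
-/

noncomputable section

set_option linter.dupNamespace false

open MeasureTheory Set Function Filter Topology TopologicalSpace Metric
open scoped NNReal ENNReal

namespace Summit.NavierStokesRegularity.NavierStokesRegularity.Theorems.AxisymmetricKatoGlobal.EulerScaling

open Literature.Analysis.FluidPDE

/-- The bad set of a finite family of cylinders is measurable. [folklore] -/
theorem measurableSet_badSet (s : Finset ℕ) (z : ℕ → ℝ × EuclideanSpace ℝ (Fin 3)) (r : ℕ → ℝ) :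
    MeasurableSet (⋃ i ∈ s, Icc ((z i).1 - 2 * r i ^ 2) ((z i).1 + 2 * r i ^ 2) ×ˢ
      ball (z i).2 (4 * r i)) :=
  Finset.measurableSet_biUnion _ fun _ _ => measurableSet_Icc.prod measurableSet_ball

/-- **Points off `C` are eventually outside the bad sets.** Let `(sₙ, zₙ, rₙ)` be covers whose
cylinders have radii in `]0,1[` summing to `≤ εₙ`, each meeting the closed set `C`, with `εₙ → 0`.
Then every `w ∉ C` lies outside `Badₙ` for all large `n`. [folklore] -/
theorem eventually_notMem_badSet {C : Set (ℝ × EuclideanSpace ℝ (Fin 3))} (hC : IsClosed C)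
    {s : ℕ → Finset ℕ} {z : ℕ → ℕ → ℝ × EuclideanSpace ℝ (Fin 3)} {r : ℕ → ℕ → ℝ} {ε : ℕ → ℝ}
    (hr : ∀ n, ∀ i ∈ s n, 0 < r n i ∧ r n i < 1) (hsum : ∀ n, ∑ i ∈ s n, r n i ≤ ε n)
    (hmeet : ∀ n, ∀ i ∈ s n, (parabolicCylinderCentered (r n i) (z n i) ∩ C).Nonempty)
    (hε : Tendsto ε atTop (𝓝 0)) {w : ℝ × EuclideanSpace ℝ (Fin 3)} (hw : w ∉ C) :
    ∀ᶠ n in atTop, w ∉ ⋃ i ∈ s n, Icc ((z n i).1 - 2 * r n i ^ 2) ((z n i).1 + 2 * r n i ^ 2) ×ˢ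
      ball (z n i).2 (4 * r n i) := by
  obtain ⟨d, hd, hdC⟩ := exists_pos_le_dist_of_notMem hC hw
  have hev : ∀ᶠ n in atTop, ε n < d / 6 := (tendsto_order.1 hε).2 _ (by linarith)
  filter_upwards [hev] with n hn hmem
  obtain ⟨i, hi, hwi⟩ := mem_iUnion₂.1 hmem
  have hri : r n i ≤ ε n :=
    (Finset.single_le_sum (f := fun j => r n j) (fun j hj => (hr n j hj).1.le) hi).trans (hsum n)
  have ht : |w.1 - (z n i).1| ≤ 2 * r n i ^ 2 := by
    rw [abs_le]; constructor <;> linarith [hwi.1.1, hwi.1.2]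
  have h4 := le_dist_of_meeting hdC (hr n i hi).2 hri (by linarith) (hmeet n i hi) ht
  exact (not_lt.2 h4) (mem_ball.1 hwi.2)

/-- **Fatou for the dissipation.** If a.e. point is eventually outside the measurable sets `Bₙ`,
then `∫⁻ f ≤ liminf ∫⁻ 1_{Bₙᶜ} f` for every a.e.-measurable `f ≥ 0`. [folklore] -/
theorem lintegral_le_liminf_lintegral_indicator_compl {α : Type*} [MeasurableSpace α] {μ : Measure α}
    {f : α → ℝ≥0∞} (hf : AEMeasurable f μ) {B : ℕ → Set α} (hB : ∀ n, MeasurableSet (B n))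
    (hev : ∀ᵐ w ∂μ, ∀ᶠ n in atTop, w ∉ B n) :
    ∫⁻ w, f w ∂μ ≤ Filter.liminf (fun n => ∫⁻ w, (B n)ᶜ.indicator f w ∂μ) atTop := by
  have hlim : ∀ᵐ w ∂μ, Filter.liminf (fun n => (B n)ᶜ.indicator f w) atTop = f w := by
    filter_upwards [hev] with w hw
    rw [Filter.liminf_congr (v := fun _ => f w) (by
      filter_upwards [hw] with n hn
      rw [indicator_of_mem (mem_compl hn)])]
    exact Filter.liminf_const _
  calc ∫⁻ w, f w ∂μ = ∫⁻ w, Filter.liminf (fun n => (B n)ᶜ.indicator f w) atTop ∂μ :=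
        lintegral_congr_ae (by filter_upwards [hlim] with w hw; rw [hw])
    _ ≤ Filter.liminf (fun n => ∫⁻ w, (B n)ᶜ.indicator f w ∂μ) atTop :=
        lintegral_liminf_le' fun n => hf.indicator (hB n).compl

/-- **Dominated convergence for the excised drift / axis terms.** If a.e. point is eventually
outside the measurable sets `Bₙ` and `g` is integrable, then `∫ 1_{Bₙ} ‖g‖ → 0`. [folklore] -/
theorem tendsto_integral_indicator_norm_zero {α : Type*} [MeasurableSpace α] {μ : Measure α}
    {g : α → ℝ} (hg : Integrable g μ) {B : ℕ → Set α} (hB : ∀ n, MeasurableSet (B n))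
    (hev : ∀ᵐ w ∂μ, ∀ᶠ n in atTop, w ∉ B n) :
    Tendsto (fun n => ∫ w, (B n).indicator (fun w => ‖g w‖) w ∂μ) atTop (𝓝 0) := by
  have h := tendsto_integral_of_dominated_convergence (fun w => ‖g w‖)
    (F := fun n w => (B n).indicator (fun w => ‖g w‖) w) (f := fun _ => 0)
    (fun n => (hg.norm.aestronglyMeasurable.indicator (hB n))) hg.norm
    (fun n => Eventually.of_forall fun w => by
      rw [Real.norm_eq_abs, abs_of_nonneg (indicator_nonneg (fun _ _ => norm_nonneg _) _)]
      exact Set.indicator_le_self' (fun x _ => norm_nonneg (g x)) w)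
    (by
      filter_upwards [hev] with w hw
      refine tendsto_const_nhds.congr' ?_
      filter_upwards [hw] with n hn
      rw [indicator_of_notMem hn])
  simpa using h

/-- **Weighted vs unweighted integral.** If `0 ≤ φ ≤ 1`, `φ = 1` off the measurable set `B`
(a.e.), and `T`, `1_B‖T‖` are integrable, then `|∫ φ² T - ∫ T| ≤ ∫ 1_B ‖T‖`. [folklore] -/
theorem abs_integral_weight_sub_le {α : Type*} [MeasurableSpace α] {μ : Measure α}
    {T φ : α → ℝ} (hT : Integrable T μ) (hφT : Integrable (fun w => φ w ^ 2 * T w) μ)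
    {B : Set α} (hB : MeasurableSet B) (hφ0 : ∀ w, 0 ≤ φ w) (hφ1 : ∀ w, φ w ≤ 1)
    (hφB : ∀ᵐ w ∂μ, w ∉ B → φ w = 1) :
    |(∫ w, φ w ^ 2 * T w ∂μ) - ∫ w, T w ∂μ| ≤ ∫ w, B.indicator (fun w => ‖T w‖) w ∂μ := by
  rw [← integral_sub hφT hT, ← Real.norm_eq_abs]
  refine norm_integral_le_of_norm_le ((hT.norm).indicator hB) ?_
  filter_upwards [hφB] with w hw
  by_cases hwB : w ∈ B
  · rw [indicator_of_mem hwB, Real.norm_eq_abs, Real.norm_eq_abs]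
    have h1 : |φ w ^ 2 * T w - T w| = (1 - φ w ^ 2) * |T w| := by
      rw [show φ w ^ 2 * T w - T w = -((1 - φ w ^ 2) * T w) by ring, abs_neg, abs_mul,
        abs_of_nonneg (by nlinarith [hφ0 w, hφ1 w])]
    rw [h1]
    have h2 : 0 ≤ φ w ^ 2 := sq_nonneg _
    nlinarith [abs_nonneg (T w)]
  · rw [indicator_of_notMem hwB, hw hwB, one_pow, one_mul, sub_self, norm_zero]

/-- **Weighted dissipation dominates the dissipation off the bad set.** If `φ = 1` off `B`, then
`∫⁻ 1_{Bᶜ} (ofReal D) ≤ ∫⁻ ofReal (D φ²)` (any real `D`; in use `D ≥ 0` is the dissipation density).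
[folklore] -/
theorem lintegral_indicator_compl_le_weight {α : Type*} [MeasurableSpace α] {μ : Measure α}
    {D φ : α → ℝ} {B : Set α} (hφB : ∀ w, w ∉ B → φ w = 1) :
    ∫⁻ w, Bᶜ.indicator (fun w => ENNReal.ofReal (D w)) w ∂μ ≤ ∫⁻ w, ENNReal.ofReal (D w * φ w ^ 2) ∂μ := by
  refine lintegral_mono fun w => ?_
  by_cases hwB : w ∈ B
  · rw [indicator_of_notMem (Set.notMem_compl_iff.2 hwB)]; exact bot_le
  · rw [indicator_of_mem (mem_compl hwB), hφB w hwB, one_pow, mul_one]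

/-- **A weight in `[0,1]` only decreases a nonnegative integral**: `∫ φ² T ≤ ∫ T` for `T ≥ 0`
integrable. [folklore] -/
theorem integral_weight_le {α : Type*} [MeasurableSpace α] {μ : Measure α}
    {T φ : α → ℝ} (hT : Integrable T μ) (hT0 : ∀ w, 0 ≤ T w) (hφ0 : ∀ w, 0 ≤ φ w) (hφ1 : ∀ w, φ w ≤ 1) :
    (∫ w, φ w ^ 2 * T w ∂μ) ≤ ∫ w, T w ∂μ := by
  refine integral_mono_of_nonneg (Eventually.of_forall fun w => mul_nonneg (sq_nonneg _) (hT0 w)) hT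
    (Eventually.of_forall fun w => ?_)
  have h2 : φ w ^ 2 ≤ 1 := by nlinarith [hφ0 w, hφ1 w]
  nlinarith [hT0 w]

end Summit.NavierStokesRegularity.NavierStokesRegularity.Theorems.AxisymmetricKatoGlobal.EulerScaling

end
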